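import Literature.AlgebraicGeometry.Motives.WeilJacobianDimension
import Literature.AlgebraicGeometry.Motives.JacobianBrillNoetherLocusPoints
import HarnessLib

/-!
# The dense open of Step I on Weil's Jacobian: general sums of `g` distinct points with a unique summand tuple

Layer `Literature/AlgebraicGeometry/Motives`, namespace `….Motives.WeilJacobian`.  KERNEL ONLY (theorems; no definition, no
named fact, no instance, no `sorry`).  Sequel of ★ `Motives/WeilJacobianDimension` (Weil's Jacobian `Jac`, the map
`f : C → J`, `Q ↦ [Q − R₀(j₀)]`, the class map `clsX`) and of ★ `Motives/JacobianBrillNoetherLocusPoints` (geometric points over the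
image of a morphism).

## The mathematics ([Milne1986JacobianVarieties] §5 Thm. 5.1 (a), §6 Lemma 6.7; [Lange2023AbelianVarietiesComplex] §4.4.2 Lemma 4.4.4 Step I)

Let `C` be a smooth projective curve over an algebraically closed field `K` of characteristic `0`, `J = Jac` Weil's Jacobian
(★ `WeilJacobian.Jac`, built on the chart `W = {ℓ = 1} ⊆ C^{(g)}`), `f = fJ : C → J` the map `Q ↦ [Q − R₀(j₀)]`.  For a tuple
`τ = (τ₁, …, τ_g)` of `K`-points write `Σf(τ) := ∏ⱼ f(τⱼ) ∈ J(K)`; its class is `[Σⱼ τⱼ − g·R₀(j₀)]` (§1), so `Σf(τ′) = Σf(τ)` iff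
`Σ τ′ⱼ ∼ Σ τⱼ` (§1), and when `ℓ(Σ τⱼ) = 1` the effective divisor `Σ τⱼ` is alone in its class, so `τ′` is a PERMUTATION of `τ` (§2;
Milne §5: «the fibre of `f^{(g)}` through `D` is the linear system `|D|`», of dimension `ℓ(D) − 1 = 0`).  The tuples with
`ℓ(Σ τⱼ) = 1` (★ `generalLocus`, open by semicontinuity) and pairwise distinct entries (off the big diagonals, which are images of
the proper `Cᵍ`) form a non-empty open `V ⊆ Cᵍ`; since `Σf : Cᵍ → J` is proper, `U := J ∖ Σf(Cᵍ ∖ V)` is OPEN, it is non-empty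
(it contains `Σf(τ₀)` for any `τ₀ ∈ V(K)`: a point of `Cᵍ ∖ V` over it would be a permutation of `τ₀`), and every `K`-point `a` of
`U` is `Σf(τ)` for a tuple `τ ∈ V(K)` — `g` DISTINCT points, UNIQUE up to permutation (§3).  This is the open set `U` of Milne's
Lemma 6.7 / Lange's Lemma 4.4.4 Step I («for general `x`, `h⁰ = 1` and `g` pairwise different points»).

## What is proved
§1 `clsX_prod`, `clsX_prod_comp_fJ` (`clsX (Σf(τ)) = [Σⱼτⱼ − g·R₀(j₀)]`), `prod_comp_fJ_eq_iff_isLinearlyEquivalent`; §2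
`exists_perm_of_tupleDiv_eq`, **`exists_perm_of_prod_comp_fJ_eq_of_ell_eq_one`** (uniqueness of the summand tuple when `ℓ = 1`);
§3 `tuplePt_comp_prod_coord_fJ`, `exists_tuple_prod_comp_fJ_eq` (`Σf` is onto `J(K)`), the diagonal bookkeeping, and
**`exists_opens_general_sum`** (letter (L-a) of the cell `hodgecm-mathlib`, road G4, Step I; census A-p02 (g15) `CENSUS-g43` §5,
pen A-p04 (g17) 08:07:53Z).  COUNT-NEUTRAL.  HC_CM is proved only modulo the 7 printed citations until rung 0 closes; this file
moves no book by itself.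

## References
* [Milne1986JacobianVarieties] J. S. Milne, *Jacobian Varieties* (1986), §5 Thm. 5.1 (a) (the fibres of `f^{(r)}` are linear
  systems), §6 Lemma 6.7 (p. 187).
* [Lange2023AbelianVarietiesComplex] H. Lange, *Abelian Varieties over the Complex Numbers* (2023), §4.4.2 Lemma 4.4.4 (Step I: the
  open set `U`).
* [GortzWedhorn2020] U. Görtz, T. Wedhorn, *Algebraic Geometry I*, 2nd ed. (2020), Prop. 12.58 (p. 349), Cor. 3.36 (p. 83).
-/

set_option autoImplicit false

noncomputable section

universe u

open CategoryTheory CategoryTheory.Limits AlgebraicGeometry MonoidalCategory CartesianMonoidalCategory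
  TopologicalSpace MonObj
open Literature.NumberTheory.DiophantineGeometry
open Literature.NumberTheory.DiophantineGeometry.AlgFunctionField
open Literature.AlgebraicGeometry.RelativeSpec

namespace Literature.AlgebraicGeometry.Motives

open RatFn FieldPoint CartierDivisor CurvePlaces

namespace WeilJacobian

variable {K : Type u} [Field K] [IsAlgClosed K] [CharZero K]
  (C : SchemeOver K) [IsIntegral C.left] [SmoothOfRelativeDimension 1 C.hom] [IsProper C.hom]
  [GeometricallyIntegral C.hom] (hC : IsProjectiveOver C) (hX : CechPseudoCoherentAt C) (g : ℕ)
  (hg : (genus K (curveBC C (strPt (K := K) K)).left.functionField : ℤ) ≤ g)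
  (hW : (chartW C g hC).Nonempty) (j₀ : Fin g)

/-! ## §1 The class of an Abel sum `Σf(τ) = ∏ⱼ f(τⱼ)` -/

/-- `clsX` of a finite product is the sum of the classes (★ `clsX_mul`, `clsX_one`): the class map `J(K) → Cl(C)` is a
homomorphism. [cite: Milne1986JacobianVarieties, §7 (Weil's construction)] -/
theorem clsX_prod {J : Type*} (s : Finset J) (x : J → (specOver K K ⟶ (Jac C hC hX g hg hW).X)) :
    clsX C hC hX g hg hW (∏ i ∈ s, x i) = ∑ i ∈ s, clsX C hC hX g hg hW (x i) := by
  classical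
  induction s using Finset.induction_on with
  | empty => rw [Finset.prod_empty, Finset.sum_empty, clsX_one]
  | insert a s ha ih => rw [Finset.prod_insert ha, Finset.sum_insert ha, clsX_mul, ih]

/-- **`clsX (∏ⱼ f(τⱼ)) = [Σⱼ τⱼ − n·R₀(j₀)]`** (★ `clsX_comp_fJ`: `clsX (f Q) = [Q − R₀(j₀)]`). [cite: Milne1986JacobianVarieties, §7 (the map `C → J`)] -/
theorem clsX_prod_comp_fJ {n : ℕ} (τ : Fin n → AlgPoints C K) :
    clsX C hC hX g hg hW (∏ j, τ j ≫ fJ C hC hX g hg hW j₀) =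
      DivisorClass.mk (tupleDiv C τ - n • ptDiv C (baseTuple C hC hX g hW j₀)) := by
  rw [clsX_prod]
  simp only [clsX_comp_fJ]
  change ∑ x, QuotientAddGroup.mk' (principalDivisors K _) (ptDiv C (τ x) - ptDiv C (baseTuple C hC hX g hW j₀)) =
    QuotientAddGroup.mk' (principalDivisors K _) _
  rw [← map_sum, Finset.sum_sub_distrib, Finset.sum_const, Finset.card_univ, Fintype.card_fin]

/-- **`∏ⱼ f(τ′ⱼ) = ∏ⱼ f(τⱼ)` iff `Σⱼ τ′ⱼ ∼ Σⱼ τⱼ`** (★ `clsX_injective` and §1). [cite: Milne1986JacobianVarieties, §5 Thm. 5.1 (a)] -/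
theorem prod_comp_fJ_eq_iff_isLinearlyEquivalent {n : ℕ} (τ τ' : Fin n → AlgPoints C K) :
    (∏ j, τ' j ≫ fJ C hC hX g hg hW j₀) = (∏ j, τ j ≫ fJ C hC hX g hg hW j₀) ↔
      (tupleDiv C τ').IsLinearlyEquivalent (tupleDiv C τ) := by
  constructor
  · intro h
    have h1 := congrArg (clsX C hC hX g hg hW) h
    rw [clsX_prod_comp_fJ, clsX_prod_comp_fJ, DivisorClass.mk_eq_mk_iff] at h1
    change (tupleDiv C τ' - n • ptDiv C (baseTuple C hC hX g hW j₀) -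
      (tupleDiv C τ - n • ptDiv C (baseTuple C hC hX g hW j₀))).IsPrincipal at h1
    rw [sub_sub_sub_cancel_right] at h1
    exact h1
  · intro h
    apply clsX_injective C hC hX g hg hW
    rw [clsX_prod_comp_fJ, clsX_prod_comp_fJ, DivisorClass.mk_eq_mk_iff]
    change (tupleDiv C τ' - n • ptDiv C (baseTuple C hC hX g hW j₀) -
      (tupleDiv C τ - n • ptDiv C (baseTuple C hC hX g hW j₀))).IsPrincipal
    rw [sub_sub_sub_cancel_right]
    exact h

/-! ## §2 Uniqueness of the summand tuple when `ℓ(Σⱼ τⱼ) = 1` -/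

omit [IsAlgClosed K] [CharZero K] [IsIntegral C.left] in
/-- **Tuples with the same divisor `Σⱼ[τⱼ]` differ by a permutation** (★ `exists_perm_of_sum_single_eq` + injectivity of
`Q ↦ [Q]`). [cite: Milne1986JacobianVarieties, §3 Prop. 3.1 and Thm. 3.13 (field-valued points)] -/
theorem exists_perm_of_tupleDiv_eq {n : ℕ} (τ τ' : Fin n → AlgPoints C K) (h : tupleDiv C τ' = tupleDiv C τ) :
    ∃ σ : Equiv.Perm (Fin n), τ' = τ ∘ σ := by
  classical
  obtain ⟨σ, hσ⟩ := exists_perm_of_sum_single_eq _ _ h.symm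
  refine ⟨σ, funext fun i => ?_⟩
  have hi := place_injective (C := curveBC C (strPt (K := K) K)) _ _ (hσ i)
  exact ratPtPoint_injective C _ hi

/-- **When `ℓ(Σⱼ τⱼ) = 1`, `∏ⱼ f(τ′ⱼ) = ∏ⱼ f(τⱼ)` forces `τ′` to be a permutation of `τ`**: `Σ τ′ⱼ ∼ Σ τⱼ` (§1), both
effective, and an effective divisor with `ℓ = 1` is alone in its class (★ `eq_of_isLinearlyEquivalent_of_ell_eq_one`).  Milne §5:
«the fibre of `f^{(g)}` containing `D` is the linear system `|D|`». [cite: Milne1986JacobianVarieties, §5 Thm. 5.1 (a)] -/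
theorem exists_perm_of_prod_comp_fJ_eq_of_ell_eq_one {n : ℕ} (τ : Fin n → AlgPoints C K) (hℓ : ell (tupleDiv C τ) = 1)
    (τ' : Fin n → AlgPoints C K) (h : (∏ j, τ' j ≫ fJ C hC hX g hg hW j₀) = (∏ j, τ j ≫ fJ C hC hX g hg hW j₀)) :
    ∃ σ : Equiv.Perm (Fin n), τ' = τ ∘ σ := by
  have hlin := (prod_comp_fJ_eq_iff_isLinearlyEquivalent C hC hX g hg hW j₀ τ τ').mp h
  have heq : tupleDiv C τ = tupleDiv C τ' :=
    eq_of_isLinearlyEquivalent_of_ell_eq_one (tupleDiv_nonneg C τ) (tupleDiv_nonneg C τ')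
      (Divisor.IsLinearlyEquivalent.symm' hlin) hℓ
  exact exists_perm_of_tupleDiv_eq C τ τ' heq.symm

/-! ## §3 The Abel-sum morphism `Σf : Cᵍ → J`, the diagonals, and the dense open -/

/-- A `T`-valued point of `Cᵍ` followed by `Σf := ∏ⱼ prⱼ ≫ f` is `∏ⱼ f(prⱼ)` (★ `Jacobian.comp_prod`; Milne's `f^r(P₁,…,P_r) = Σ f(Pᵢ)`).
[cite: Milne1986JacobianVarieties, §5 (the maps f^r : C^r → J)] -/
theorem comp_prod_coord_fJ {T : SchemeOver K} (ω : T ⟶ powC C g) :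
    ω ≫ (∏ j, coord C g j ≫ fJ C hC hX g hg hW j₀) = ∏ j, (ω ≫ coord C g j) ≫ fJ C hC hX g hg hW j₀ := by
  rw [Jacobian.comp_prod]
  exact Finset.prod_congr rfl fun j _ => (Category.assoc _ _ _).symm

/-- The tuple point `(τ₁, …, τ_g)` followed by `Σf` is `∏ⱼ f(τⱼ)` (`f^g(τ) = Σⱼ f(τⱼ)`). [cite: Milne1986JacobianVarieties, §5 (the maps f^r : C^r → J)] -/
theorem tuplePt_comp_prod_coord_fJ (τ : Fin g → AlgPoints C K) :
    tuplePt C (strPt (K := K) K) τ ≫ (∏ j, coord C g j ≫ fJ C hC hX g hg hW j₀) = ∏ j, τ j ≫ fJ C hC hX g hg hW j₀ := by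
  rw [comp_prod_coord_fJ]
  exact Finset.prod_congr rfl fun j _ => congrArg (· ≫ fJ C hC hX g hg hW j₀) (tuplePt_coord C _ τ j)

/-- **`Σf` is onto `J(K)`**: every `K`-point `a` of `J` is `∏ⱼ f(τⱼ)` for some tuple — `clsX a = [E − Σ[R′]]` on a chart, and
the class `E − Σ[R′] + g·[R₀(j₀)]` of degree `g ≥ genus` contains an effective `Σⱼ[τⱼ]` (★ `exists_tuple_isLinearlyEquivalent`,
Riemann–Roch). [cite: Milne1986JacobianVarieties, §7 (Weil's construction)] -/
theorem exists_tuple_prod_comp_fJ_eq (a : specOver K K ⟶ (Jac C hC hX g hg hW).X) :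
    ∃ τ : Fin g → AlgPoints C K, (∏ j, τ j ≫ fJ C hC hX g hg hW j₀) = a := by
  obtain ⟨R', x, hx⟩ := exists_comp_chartX_eq C hC hX g hg hW a
  have hdeg : (liftDiv C g hC (x ≫ ιW C hC hX g) - tupleDiv C R' +
      g • ptDiv C (baseTuple C hC hX g hW j₀)).degree = g := by
    rw [map_add, map_sub, map_nsmul, degree_liftDiv, degree_tupleDiv, degree_ptDiv]; simp
  obtain ⟨τ, hτ⟩ := exists_tuple_isLinearlyEquivalent C hdeg hg
  replace hτ : (tupleDiv C τ).IsLinearlyEquivalent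
      (liftDiv C g hC (x ≫ ιW C hC hX g) - tupleDiv C R' + g • ptDiv C (baseTuple C hC hX g hW j₀)) := hτ
  refine ⟨τ, clsX_injective C hC hX g hg hW ?_⟩
  rw [clsX_prod_comp_fJ, ← hx, clsX_comp_chartX, DivisorClass.mk_eq_mk_iff]
  change (tupleDiv C τ - g • ptDiv C (baseTuple C hC hX g hW j₀) -
    (liftDiv C g hC (x ≫ ιW C hC hX g) - tupleDiv C R')).IsPrincipal
  have h2 : tupleDiv C τ - g • ptDiv C (baseTuple C hC hX g hW j₀) - (liftDiv C g hC (x ≫ ιW C hC hX g) - tupleDiv C R') =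
      tupleDiv C τ - (liftDiv C g hC (x ≫ ιW C hC hX g) - tupleDiv C R' + g • ptDiv C (baseTuple C hC hX g hW j₀)) := by
    abel
  rw [h2]
  exact hτ

omit [IsAlgClosed K] [CharZero K] in
/-- **`K`-points of `Cᵍ`: general iff `ℓ(Σⱼ[ωⱼ]) = 1`** (★ `imagePtPow_mem_generalLocus_iff` read on the coordinates).
[cite: Milne1986JacobianVarieties, §4 Prop. 4.2 (a) and §5 Thm. 5.1] -/
theorem pt_mem_generalLocus_iff (ω : AlgPoints (powC C g) K) :
    ω.pt ∈ generalLocus C g ↔ ell (tupleDiv C fun j => ω ≫ coord C g j) = 1 := by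
  have h := imagePtPow_mem_generalLocus_iff C g (strPt (K := K) K) ω
  rw [← tuplePt_comp_coord C g (strPt (K := K) K) ω, coordDivisorAt_tuplePt_eq_tupleDiv, tuplePt_comp_coord] at h
  exact h

omit [IsAlgClosed K] [CharZero K] [IsIntegral C.left] [SmoothOfRelativeDimension 1 C.hom] [IsProper C.hom]
  [GeometricallyIntegral C.hom] in
/-- The coordinates of the diagonal map `δ_{ij} : Cᵍ → Cᵍ` (replace the `j`-th coordinate by the `i`-th). [folklore] -/
private theorem diagMap_coord (i j l : Fin g) :
    liftOver C.hom g (fun l => coord C g (if l = j then i else l)) ≫ coord C g l = coord C g (if l = j then i else l) :=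
  liftOver_projOver C.hom g _ l

omit [IsAlgClosed K] [CharZero K] [IsIntegral C.left] [SmoothOfRelativeDimension 1 C.hom] [IsProper C.hom]
  [GeometricallyIntegral C.hom] in
/-- A tuple with `τᵢ = τⱼ` is fixed by `δ_{ij}`; in particular its point lies in the image of `δ_{ij}`. [folklore] -/
private theorem tuplePt_comp_diagMap_of_eq (τ : Fin g → AlgPoints C K) {i j : Fin g} (h : τ i = τ j) :
    tuplePt C (strPt (K := K) K) τ ≫ liftOver C.hom g (fun l => coord C g (if l = j then i else l)) =
      tuplePt C (strPt (K := K) K) τ := by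
  refine hom_ext_projOver C.hom g _ _ fun l => ?_
  change (tuplePt C _ τ ≫ liftOver C.hom g (fun l => coord C g (if l = j then i else l))) ≫ coord C g l =
    tuplePt C _ τ ≫ coord C g l
  rw [Category.assoc, diagMap_coord, tuplePt_coord, tuplePt_coord]
  by_cases hl : l = j
  · rw [if_pos hl, hl, h]
  · rw [if_neg hl]

omit [CharZero K] [IsIntegral C.left] [SmoothOfRelativeDimension 1 C.hom] [IsProper C.hom] [GeometricallyIntegral C.hom] in
/-- **A `K`-point of `Cᵍ` in the image of `δ_{ij}` has `τᵢ = τⱼ`** (lift the `K`-point along `δ_{ij}`, ★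
`Morphisms.exists_over_comp_eq_of_mem_range`, and compare coordinates). [cite: GortzWedhorn2020, Cor. 3.36 (p. 83) and Prop. 4.8 (p. 98)] -/
theorem apply_eq_of_pt_mem_range_diagMap [LocallyOfFiniteType (powC C g).hom] (τ : Fin g → AlgPoints C K) {i j : Fin g}
    (h : AlgPoints.pt (tuplePt C (strPt (K := K) K) τ) ∈
      Set.range (liftOver C.hom g (fun l => coord C g (if l = j then i else l)) : powC C g ⟶ powC C g).left) :
    τ i = τ j := by
  set δ : powC C g ⟶ powC C g := liftOver C.hom g (fun l => coord C g (if l = j then i else l)) with hδ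
  haveI : LocallyOfFiniteType (δ.left ≫ (powC C g).hom) := by rw [Over.w δ]; infer_instance
  haveI : LocallyOfFiniteType δ.left := locallyOfFiniteType_of_comp δ.left (powC C g).hom
  obtain ⟨ω, hω⟩ := Morphisms.exists_over_comp_eq_of_mem_range δ (strPt (K := K) K) (tuplePt C (strPt (K := K) K) τ) h
  have hi : τ i = ω ≫ coord C g i := by
    rw [← tuplePt_coord C (strPt (K := K) K) τ i, ← hω, Category.assoc, hδ, diagMap_coord]
    by_cases hij : i = j
    · rw [if_pos hij]
    · rw [if_neg hij]
  have hj : τ j = ω ≫ coord C g i := by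
    rw [← tuplePt_coord C (strPt (K := K) K) τ j, ← hω, Category.assoc, hδ, diagMap_coord, if_pos rfl]
  rw [hi, hj]

/-- **THE DENSE OPEN OF STEP I (letter (L-a) on Weil's model).**  There is a non-empty open `U ⊆ J` such that every `K`-point
`a` of `U` is `Σf(τ) = ∏ⱼ f(τⱼ)` for a tuple `τ` of `g` PAIRWISE DISTINCT points of `C` which is UNIQUE up to permutation among all
tuples with that Abel sum (`ℓ(Σⱼ τⱼ) = 1`).  `U := J ∖ Σf(Cᵍ ∖ V)`, `V` = general locus off the big diagonals; `Σf` and the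
diagonal maps are proper (★ `isProper_powOver_base`), `Σf` is onto `J(K)` (§3), uniqueness on `V` is §2, and `U ∋ Σf(τ₀)` for any
`τ₀ ∈ V(K)` (`V ≠ ∅`: `Cᵍ` is irreducible, the general locus is non-empty by `hW`, and `C` has two distinct points).
Milne JV Lemma 6.7: «let `U` be the largest open subset of `J` such that the fibre of `f^{(g)}` … `D(a)` is a sum of `g` distinct
points»; Lange Lemma 4.4.4 Step I: «`U` is open and dense in `J`». [cite: Milne1986JacobianVarieties, §6 Lemma 6.7 (p. 187)]
[cite: Lange2023AbelianVarietiesComplex, §4.4.2 Lemma 4.4.4 (Step I)] [cite: GortzWedhorn2020, Prop. 12.58 (p. 349)] -/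
theorem exists_opens_general_sum :
    ∃ U : (Jac C hC hX g hg hW).X.left.Opens, (U : Set (Jac C hC hX g hg hW).X.left).Nonempty ∧
      ∀ a : specOver K K ⟶ (Jac C hC hX g hg hW).X, AlgPoints.pt a ∈ U →
        ∃ τ : Fin g → AlgPoints C K, Function.Injective τ ∧ (∏ j, τ j ≫ fJ C hC hX g hg hW j₀) = a ∧
          ∀ τ' : Fin g → AlgPoints C K, (∏ j, τ' j ≫ fJ C hC hX g hg hW j₀) = a →
            ∃ σ : Equiv.Perm (Fin g), τ' = τ ∘ σ := by
  classical
  -- the Abel-sum morphism `Φ = Σf` and the diagonal maps `δ (i, j)`, as opaque locals with their defining equations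
  obtain ⟨Φ, hΦ⟩ : ∃ Φ : powC C g ⟶ (Jac C hC hX g hg hW).X, Φ = ∏ j, coord C g j ≫ fJ C hC hX g hg hW j₀ := ⟨_, rfl⟩
  obtain ⟨δ, hδ⟩ : ∃ δ : Fin g × Fin g → (powC C g ⟶ powC C g),
      δ = fun p => liftOver C.hom g (fun l => coord C g (if l = p.2 then p.1 else l)) := ⟨_, rfl⟩
  have hΦτ : ∀ τ : Fin g → AlgPoints C K,
      tuplePt C (strPt (K := K) K) τ ≫ Φ = ∏ j, τ j ≫ fJ C hC hX g hg hW j₀ := fun τ => by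
    rw [hΦ]; exact tuplePt_comp_prod_coord_fJ C hC hX g hg hW j₀ τ
  have hΦω : ∀ ω : AlgPoints (powC C g) K, ω ≫ Φ = ∏ j, (ω ≫ coord C g j) ≫ fJ C hC hX g hg hW j₀ := fun ω => by
    rw [hΦ]; exact comp_prod_coord_fJ C hC hX g hg hW j₀ ω
  have hδfix : ∀ (τ : Fin g → AlgPoints C K) (i j : Fin g), τ i = τ j →
      tuplePt C (strPt (K := K) K) τ ≫ δ (i, j) = tuplePt C (strPt (K := K) K) τ := fun τ i j h => by
    rw [hδ]; exact tuplePt_comp_diagMap_of_eq C g τ h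
  have hδlift : ∀ (τ : Fin g → AlgPoints C K) (i j : Fin g),
      AlgPoints.pt (tuplePt C (strPt (K := K) K) τ) ∈ Set.range (δ (i, j)).left → τ i = τ j := fun τ i j h => by
    rw [hδ] at h; exact apply_eq_of_pt_mem_range_diagMap C g τ h
  -- properness: `Cᵍ` proper, `J` and `Cᵍ` separated ⇒ `Φ` and the `δ p` are closed maps
  haveI hP : IsProper (powC C g).hom := isProper_powOver_base C.hom g
  haveI : IsProper (Jac C hC hX g hg hW).X.hom := (Jac C hC hX g hg hW).isProper
  haveI : IsProper Φ.left := by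
    have h : IsProper (Φ.left ≫ (Jac C hC hX g hg hW).X.hom) := by rw [Over.w Φ]; infer_instance
    exact IsProper.of_comp Φ.left (Jac C hC hX g hg hW).X.hom
  have hδc : ∀ p : Fin g × Fin g, IsClosed (Set.range (δ p).left) := fun p => by
    have h : IsProper ((δ p).left ≫ (powC C g).hom) := by rw [Over.w (δ p)]; infer_instance
    haveI : IsProper (δ p).left := IsProper.of_comp (δ p).left (powC C g).hom
    exact (δ p).left.isClosedMap.isClosed_range
  -- the bad closed set `Z = (general locus)ᶜ ∪ ⋃_{i ≠ j} δ_{ij}(Cᵍ)` and the open `U = (Φ(Z))ᶜ`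
  obtain ⟨D, hD⟩ : ∃ D : Set (powC C g).left,
      D = ⋃ p : {p : Fin g × Fin g // p.1 ≠ p.2}, Set.range (δ p.1).left := ⟨_, rfl⟩
  have hDc : IsClosed D := by rw [hD]; exact isClosed_iUnion_of_finite fun p => hδc p.1
  obtain ⟨Z, hZ⟩ : ∃ Z : Set (powC C g).left, Z = (generalLocus C g)ᶜ ∪ D := ⟨_, rfl⟩
  have hZc : IsClosed Z := by rw [hZ]; exact (isOpen_generalLocus C g hX).isClosed_compl.union hDc
  have hUo : IsOpen (Φ.left '' Z)ᶜ := (Φ.left.isClosedMap Z hZc).isOpen_compl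
  -- K-points of `Cᵍ` outside `Z`: distinct coordinates with `ℓ = 1`
  have hgood : ∀ ω : AlgPoints (powC C g) K, ω.pt ∉ Z →
      Function.Injective (fun j => ω ≫ coord C g j) ∧ ell (tupleDiv C fun j => ω ≫ coord C g j) = 1 := by
    intro ω hω
    rw [hZ, Set.mem_union, not_or, Set.mem_compl_iff, not_not] at hω
    refine ⟨fun i j hij => ?_, (pt_mem_generalLocus_iff C g ω).mp hω.1⟩
    by_contra hne
    apply hω.2
    rw [hD, Set.mem_iUnion]
    refine ⟨⟨(i, j), hne⟩, ω.pt, ?_⟩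
    have hfix := hδfix (fun l => ω ≫ coord C g l) i j hij
    rw [tuplePt_comp_coord] at hfix
    conv_rhs => rw [← hfix]
    exact (AlgPoints.pt_comp (δ (i, j)) ω).symm
  -- conversely, good tuples lie outside `Z`
  have hgood' : ∀ τ : Fin g → AlgPoints C K, Function.Injective τ → ell (tupleDiv C τ) = 1 →
      AlgPoints.pt (tuplePt C (strPt (K := K) K) τ) ∉ Z := by
    intro τ hinj hℓ hmem
    rw [hZ, Set.mem_union, Set.mem_compl_iff, hD, Set.mem_iUnion] at hmem
    rcases hmem with hgen | ⟨⟨⟨i, j⟩, hij⟩, hr⟩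
    · apply hgen
      rw [pt_mem_generalLocus_iff C g]
      simpa only [tuplePt_coord] using hℓ
    · exact hij (hinj (hδlift τ i j hr))
  refine ⟨⟨(Φ.left '' Z)ᶜ, hUo⟩, ?_, fun a ha => ?_⟩
  · -- NON-EMPTINESS
    -- (1) the good locus `Zᶜ` is a non-empty open of the irreducible `Cᵍ`
    have hVne : (Zᶜ : Set (powC C g).left).Nonempty := by
      rw [hZ, Set.compl_union, compl_compl, hD, Set.compl_iUnion]
      have hgen : (generalLocus C g).Nonempty := by
        obtain ⟨y, t, ht, -⟩ := hW
        exact ⟨t, ht⟩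
      -- a finite intersection of non-empty opens in the irreducible `Cᵍ` is non-empty
      have hstep : ∀ S : Finset {p : Fin g × Fin g // p.1 ≠ p.2},
          (generalLocus C g ∩ ⋂ p ∈ S, (Set.range (δ p.1).left)ᶜ).Nonempty := by
        intro S
        induction S using Finset.induction_on with
        | empty => simpa using hgen
        | insert p S hp ih =>
          rw [Finset.set_biInter_insert, Set.inter_left_comm]
          -- two distinct points of `C` give a tuple off the diagonal `δ_p`
          have hne : ((Set.range (δ p.1).left)ᶜ).Nonempty := by
            haveI := infinite_algPoints C (K := K)
            obtain ⟨Q₁, Q₂, hQ⟩ := exists_pair_ne (AlgPoints C K)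
            refine ⟨AlgPoints.pt (tuplePt C (strPt (K := K) K) fun l => if l = p.1.1 then Q₁ else Q₂), fun hr => hQ ?_⟩
            have h := hδlift (fun l => if l = p.1.1 then Q₁ else Q₂) p.1.1 p.1.2 hr
            simp only [if_neg (Ne.symm p.2)] at h
            exact h
          exact nonempty_preirreducible_inter (hδc p.1).isOpen_compl
            ((isOpen_generalLocus C g hX).inter (isOpen_biInter_finset fun q _ => (hδc q.1).isOpen_compl)) hne ih
      simpa [Set.iInter_subtype] using hstep Finset.univ
    -- (2) a K-point `ω₀` in the good locus
    obtain ⟨ω₀, hω₀⟩ : ∃ ω : AlgPoints (powC C g) K, ω.pt ∈ Zᶜ := by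
      by_contra hno
      push Not at hno
      exact hVne.ne_empty (eq_empty_of_isOpen_of_forall_pt_not_mem hZc.isOpen_compl hno)
    obtain ⟨hinj₀, hℓ₀⟩ := hgood ω₀ hω₀
    -- (3) `Φ(ω₀) ∈ U`: a point of `Z` over `Φ(ω₀)` specialises to a CLOSED point of `Z` over it, i.e. a K-point, whose
    -- coordinates are a permutation of those of `ω₀` — but those are good
    refine ⟨AlgPoints.pt (ω₀ ≫ Φ), fun ⟨z, hzZ, hz⟩ => ?_⟩
    haveI : JacobsonSpace (powC C g).left := LocallyOfFiniteType.jacobsonSpace (powC C g).hom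
    have hFc : IsClosed (Z ∩ Φ.left ⁻¹' {AlgPoints.pt (ω₀ ≫ Φ)}) :=
      hZc.inter (IsClosed.preimage Φ.left.continuous (AlgPoints.isClosed_singleton_pt (ω₀ ≫ Φ)))
    obtain ⟨z', ⟨hz'Z, hz'F⟩, hz'c⟩ := nonempty_inter_closedPoints (Z := Z ∩ Φ.left ⁻¹' {AlgPoints.pt (ω₀ ≫ Φ)})
      ⟨z, hzZ, hz⟩ hFc.isLocallyClosed
    obtain ⟨ω, hω⟩ := AlgPoints.exists_pt_eq_of_isClosed_singleton (X := powC C g) (mem_closedPoints_iff.mp hz'c)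
    have hωΦ : ω ≫ Φ = ω₀ ≫ Φ := by
      apply AlgPoints.eq_of_pt_eq
      rw [AlgPoints.pt_comp, hω]
      exact hz'F
    rw [hΦω, hΦω] at hωΦ
    obtain ⟨σ, hσ⟩ := exists_perm_of_prod_comp_fJ_eq_of_ell_eq_one C hC hX g hg hW j₀ _ hℓ₀ _ hωΦ
    have hωinj : Function.Injective (fun j => ω ≫ coord C g j) := by rw [hσ]; exact hinj₀.comp σ.injective
    have hωℓ : ell (tupleDiv C fun j => ω ≫ coord C g j) = 1 := by
      rw [hσ]
      have e : tupleDiv C ((fun j => ω₀ ≫ coord C g j) ∘ σ) = tupleDiv C (fun j => ω₀ ≫ coord C g j) :=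
        Equiv.sum_comp σ (fun j => ptDiv C (ω₀ ≫ coord C g j))
      rw [e]; exact hℓ₀
    have hout := hgood' _ hωinj hωℓ
    rw [tuplePt_comp_coord] at hout
    exact hout (hω ▸ hz'Z)
  · -- THE PROPERTY: `a ∈ U(K)` is `Σf(τ)` for a good tuple
    obtain ⟨τ, hτ⟩ := exists_tuple_prod_comp_fJ_eq C hC hX g hg hW j₀ a
    have hτpt : AlgPoints.pt (tuplePt C (strPt (K := K) K) τ) ∉ Z := by
      intro hmem
      apply ha
      refine ⟨_, hmem, ?_⟩
      rw [← AlgPoints.pt_comp, hΦτ, hτ]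
    obtain ⟨hinj, hℓ⟩ := hgood _ hτpt
    simp only [tuplePt_coord] at hinj hℓ
    exact ⟨τ, hinj, hτ, fun τ' hτ' =>
      exists_perm_of_prod_comp_fJ_eq_of_ell_eq_one C hC hX g hg hW j₀ τ hℓ τ' (hτ'.trans hτ.symm)⟩

end WeilJacobian

end Literature.AlgebraicGeometry.Motives

end
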